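import Summits.BirchSwinnertonDyer.BirchSwinnertonDyer.Theorems.SignedLowerHalvesKobayashiMainConjectureSmallImageTeichSpanHeckeDefs
import Literature.NumberTheory.EllipticCurves.Rank1Residual.MuLambdaCarriers
import HarnessLib

/-!
# Route `SignedLowerHalves`, crux `KobayashiMainConjectureSmallImage` (item stmt-BirchSwinnertonDyer-19002), line `birth_acns` v12,
# stub `stub_muOneSign_ns_ge5`: **relator sets killed by Manin's homomorphism of a newform** (definitions + bookkeeping;
# cell `bsd-ssimc`, seat `bsd-line-slh-p3` gen 10, LEAD)

Second cut of the B⁰_ss idea (first cut: `…TeichSpanHeckeDefs` / `…TeichSpanHecke`, B⁰ modulo the `T_p`-images).  The dictionary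
«B⁰ modulo `G` + winding non-constancy ⟹ a unit Teichmüller-orbit sum» only uses of a relator `R ∈ G` that MANIN'S HOMOMORPHISM of the
newform, `m(γ) = 2([γ·0]⁺_f − [0]⁺_f) ∈ ℤ`, is divisible by `p` at `R` once `[0]⁺_f ≡ 0`.  This file names that property and the natural
relator set of a newform:

* `IsManinKilled f p G` — for every integer-valued `m` on `Γ₀(N)` with `m(1) = 0`, `m(xy) = m(x) + m(y)` and
  `m(γ)/2 = [b(γ)/d(γ)]⁺_f − [0]⁺_f` (`d(γ) ≠ 0`): if `[0]⁺_f ≡ 0 (mod p)` then `p ∣ m(R)` for every `R ∈ G`.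
* `heckeRelators f p` — the `T_p`-images `heckePImages N p` together with the `T_ℓ`-images `heckeLImages N p ℓ` for every prime
  `ℓ ∤ Np` whose eigenvalue `a_ℓ(f)` is an integer divisible by `p`.  For the newform of a curve of the crux's population
  (`ρ̄_{E,p}` onto the normaliser of a non-split Cartan with quadratic field `K`, `p` supersingular) these are `T_p` and `T_ℓ` for
  every good `ℓ` inert in `K` (`tr ρ̄(Frob_ℓ) = 0` off the Cartan): «B⁰ modulo `heckeRelators f p`» says that the Teichmüller packets
  span the `ι`-even winding classes of level `N` MODULO the images of these operators, i.e. it only concerns the `K`-dihedral,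
  residually supersingular eigensystems of level `N` (those `𝔪` with `T_p, T_ℓ ∈ 𝔪` for all such `ℓ`).
* bookkeeping (all proved): `IsManinKilled` is monotone / closed under `∅`, `∪`, `⋃`; the pieces of `heckeRelators` are subsets.
HONEST FRAMING: predicates only; nothing asserted about any level, form or curve; the consumers (`…TeichSpanHeckeModPrelims`,
`…TeichSpanHeckeMod`) prove `IsManinKilled f p (heckeRelators f p)` and «rider ⟸ B⁰ modulo `heckeRelators f p`».  Crux 4 stays OPEN;
BSD is not proved by any of this; no summit statement is proved by this seat.
References: [Manin1972] Prop. 1.4; [MazurTateTeitelbaum1986Invent] §I.4 (4.2), §I.10 (10.1); [Serre1972] §1.11 (trace zero off the Cartan).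
-/

-- D-0017: single-problem summit, the namespace repeats the problem name by design.
set_option linter.dupNamespace false
set_option autoImplicit false

noncomputable section

open scoped Classical MatrixGroups ModularForm
open CongruenceSubgroup Literature.NumberTheory.EllipticCurves.Rank1Residual

namespace Summit.BirchSwinnertonDyer.BirchSwinnertonDyer.Theorems.SmallImageTeichSpanHecke

open Literature.NumberTheory.EllipticCurves Literature.NumberTheory.EllipticCurves.ModularForms
  Summit.BirchSwinnertonDyer.BirchSwinnertonDyer.Cruxes.AnalyticMuZeroX9.TeichSpan

variable {N : ℕ}

/-- **`IsManinKilled f p G`** — every relator `R ∈ G ⊆ Γ₀(N)` is killed mod `p` by Manin's homomorphism of `f` once `[0]⁺_f ≡ 0`: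
for every `m : Γ₀(N) → ℤ` with `m 1 = 0`, `m(xy) = m x + m y` and `[b(γ)/d(γ)]⁺_f − [0]⁺_f = m(γ)/2` whenever `d(γ) ≠ 0` (these are the
properties of `γ ↦ re{∞,γ∞}_f/(Ω⁺_f/2)`, Manin 1972 Prop. 1.4), `‖[0]⁺_f‖_p < 1` implies `p ∣ m R`.  A PREDICATE; nothing asserted.
[cite: Manin1972, Prop. 1.4] [cite: MazurTateTeitelbaum1986Invent, §I.10 (10.1)] -/
def IsManinKilled (f : CuspForm (Gamma0 N) 2) (p : ℕ) [Fact p.Prime] (G : Set (Gamma0 N)) : Prop :=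
  ∀ m : Gamma0 N → ℤ, m 1 = 0 → (∀ x y : Gamma0 N, m (x * y) = m x + m y) →
    (∀ γ : Gamma0 N, dEntry γ ≠ 0 →
      ratPlusSymbol f (((bEntry γ : ℤ) : ℚ) / ((dEntry γ : ℤ) : ℚ)) - ratPlusSymbol f 0 = (m γ : ℚ) / 2) →
    ‖((ratPlusSymbol f 0 : ℚ) : ℚ_[p])‖ < 1 → ∀ R ∈ G, (p : ℤ) ∣ m R

/-- **The Hecke relators of a newform at `p`** — `heckeRelators f p`: the `T_p`-images of the `p`-power cusp classes (`heckePImages N p`)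
and the `T_ℓ`-images (`heckeLImages N p ℓ`) for every prime `ℓ ≠ p`, `ℓ ∤ N`, whose eigenvalue `a_ℓ(f)` is an integer divisible by `p`.
For `a_p(f) ≡ 0` these are exactly the Hecke images that Manin's homomorphism of `f` kills mod `p` (MTT §I.4 (4.2)); for the newform of
a curve with `ρ̄_{E,p}(G_ℚ)` the normaliser of a non-split Cartan (quadratic field `K`) they include `T_ℓ` for every good `ℓ` inert in `K`.
A SET; nothing asserted. [cite: MazurTateTeitelbaum1986Invent, §I.4 (4.2)] [cite: Serre1972, §1.11 (Prop. 12 and the normaliser of a Cartan subgroup)] -/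
def heckeRelators (f : CuspForm (Gamma0 N) 2) (p : ℕ) : Set (Gamma0 N) :=
  heckePImages N p ∪ ⋃ ℓ ∈ {ℓ : ℕ | ℓ.Prime ∧ ℓ ≠ p ∧ ¬ ℓ ∣ N ∧ ∃ a : ℤ, cuspCoeff f ℓ = (a : ℂ) ∧ (p : ℤ) ∣ a},
    heckeLImages N p ℓ

/-! ### Bookkeeping (all proved) -/

section Killed

variable (f : CuspForm (Gamma0 N) 2) (p : ℕ) [Fact p.Prime]

/-- Unfolding `IsManinKilled`. [cite: Manin1972, Prop. 1.4] -/
theorem isManinKilled_iff (G : Set (Gamma0 N)) :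
    IsManinKilled f p G ↔ ∀ m : Gamma0 N → ℤ, m 1 = 0 → (∀ x y : Gamma0 N, m (x * y) = m x + m y) →
      (∀ γ : Gamma0 N, dEntry γ ≠ 0 →
        ratPlusSymbol f (((bEntry γ : ℤ) : ℚ) / ((dEntry γ : ℤ) : ℚ)) - ratPlusSymbol f 0 = (m γ : ℚ) / 2) →
      ‖((ratPlusSymbol f 0 : ℚ) : ℚ_[p])‖ < 1 → ∀ R ∈ G, (p : ℤ) ∣ m R := Iff.rfl

/-- The empty relator set is killed. [cite: Manin1972, Prop. 1.4] -/
theorem isManinKilled_empty : IsManinKilled f p (∅ : Set (Gamma0 N)) :=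
  fun _ _ _ _ _ R hR ↦ absurd hR (Set.notMem_empty R)

variable {f p} in
/-- `IsManinKilled` is antitone in the set: a subset of a killed set is killed. [cite: Manin1972, Prop. 1.4] -/
theorem IsManinKilled.mono {G G' : Set (Gamma0 N)} (h : IsManinKilled f p G') (hGG' : G ⊆ G') : IsManinKilled f p G :=
  fun m h1 hmul hc h0 R hR ↦ h m h1 hmul hc h0 R (hGG' hR)

variable {f p} in
/-- The union of two killed sets is killed. [cite: Manin1972, Prop. 1.4] -/
theorem IsManinKilled.union {G G' : Set (Gamma0 N)} (h : IsManinKilled f p G) (h' : IsManinKilled f p G') :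
    IsManinKilled f p (G ∪ G') := by
  intro m h1 hmul hc h0 R hR
  rcases hR with hR | hR
  · exact h m h1 hmul hc h0 R hR
  · exact h' m h1 hmul hc h0 R hR

variable {f p} in
/-- An indexed union of killed sets is killed. [cite: Manin1972, Prop. 1.4] -/
theorem IsManinKilled.biUnion {ι : Type*} {s : Set ι} {G : ι → Set (Gamma0 N)} (h : ∀ i ∈ s, IsManinKilled f p (G i)) :
    IsManinKilled f p (⋃ i ∈ s, G i) := by
  intro m h1 hmul hc h0 R hR
  simp only [Set.mem_iUnion] at hR
  obtain ⟨i, hi, hRi⟩ := hR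
  exact h i hi m h1 hmul hc h0 R hRi

end Killed

section Relators

variable (f : CuspForm (Gamma0 N) 2) (p : ℕ)

/-- The `T_p`-images are Hecke relators. [cite: MazurTateTeitelbaum1986Invent, §I.4 (4.2)] -/
theorem heckePImages_subset_heckeRelators : heckePImages N p ⊆ heckeRelators f p :=
  Set.subset_union_left

variable {f p} in
/-- The `T_ℓ`-images of a prime `ℓ ≠ p`, `ℓ ∤ N` with `p ∣ a_ℓ(f) ∈ ℤ` are Hecke relators. [cite: MazurTateTeitelbaum1986Invent, §I.4 (4.2)] -/
theorem heckeLImages_subset_heckeRelators {ℓ : ℕ} (hℓ : ℓ.Prime) (hℓp : ℓ ≠ p) (hℓN : ¬ ℓ ∣ N) {a : ℤ}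
    (ha : cuspCoeff f ℓ = (a : ℂ)) (hpa : (p : ℤ) ∣ a) : heckeLImages N p ℓ ⊆ heckeRelators f p := by
  intro R hR
  refine Or.inr ?_
  simp only [Set.mem_iUnion, Set.mem_setOf_eq]
  exact ⟨ℓ, ⟨hℓ, hℓp, hℓN, a, ha, hpa⟩, hR⟩

/-- Unfolding membership in `heckeRelators`. [cite: MazurTateTeitelbaum1986Invent, §I.4 (4.2)] -/
theorem mem_heckeRelators_iff (R : Gamma0 N) :
    R ∈ heckeRelators f p ↔ R ∈ heckePImages N p ∨
      ∃ ℓ : ℕ, (ℓ.Prime ∧ ℓ ≠ p ∧ ¬ ℓ ∣ N ∧ ∃ a : ℤ, cuspCoeff f ℓ = (a : ℂ) ∧ (p : ℤ) ∣ a) ∧ R ∈ heckeLImages N p ℓ := by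
  simp only [heckeRelators, Set.mem_union, Set.mem_iUnion, Set.mem_setOf_eq, exists_prop]

/-- B⁰_ss implies B⁰ modulo the Hecke relators of any newform (more relators). [cite: Manin1972, Prop. 1.4] -/
theorem teichSpanGenMod_heckeRelators_of_teichSpanGenModHecke (h : TeichSpanGenModHecke N p) :
    TeichSpanGenMod N p (heckeRelators f p) :=
  teichSpanGenMod_mono (heckePImages_subset_heckeRelators f p) ((teichSpanGenModHecke_iff_teichSpanGenMod N p).mp h)

end Relators

/-! ### Appended (gen 11, third cut): the EIGEN-relators — `T_ℓ`-image words for EVERY good prime `ℓ`, corrected by `a_ℓ(f)` base words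

The second cut (gen 10) used the `T_ℓ`-images only for the primes `ℓ` with `p ∣ a_ℓ(f)`, because the Manin value of a `T_ℓ`-image word is
`2(a_ℓ[v/pⁿ]⁺ − (ℓ+1)[0]⁺)` (`…TeichSpanHeckeModPrelims.sum_heckeLImage_eq`).  Multiplying the word by `γ^{−a_ℓ}` for a `γ ∈ Γ₀(N)` carrying
the base cusp `v/pⁿ` (`d(γ) = pⁿ`, `b(γ) ≡ v`) subtracts `a_ℓ·2([v/pⁿ]⁺ − [0]⁺)` and leaves `2(a_ℓ − ℓ − 1)[0]⁺`, which Manin's homomorphism of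
`f` kills mod `p` once `[0]⁺ ≡ 0` for EVERY good prime `ℓ ≠ p` — no congruence condition on `a_ℓ(f)`.  Homologically these corrected words are
`(T_ℓ − a_ℓ(f))·{0 → v/pⁿ} + c_ℓ` (`c_ℓ = Σ_{0<j<ℓ} {0 → j/ℓ}`), so «B⁰ modulo the eigen-relators of `f`» tests the Teichmüller packets against
the `f`-ISOTYPIC part of `H₁(X₀(N);𝔽_p)⁺` only (all of `𝔪_f = (p, T_p, T_ℓ − a_ℓ(f))` is divided out), the weakest hypothesis of this shape;
under mod-`p` multiplicity one for `𝔪_f` it is EQUIVALENT to the one-sign rider (exact hinge), with no isolation condition. -/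

/-- **The EIGEN-corrected `T_ℓ`-image words** (`ℓ` a prime, `ℓ ≠ p`, `ℓ ∤ N`, `a ∈ ℤ` the intended eigenvalue `a_ℓ(f)`): a `T_ℓ`-image word
`g_0 ⋯ g_{ℓ-1} · g_ℓ` of `heckeLImages N p ℓ` at `(n, b)` (same clauses) times `γ^{−a}` for a `γ ∈ Γ₀(N)` with `d(γ) = pⁿ`, `b(γ) ≡ b (mod pⁿ)`
(the base cusp `v/pⁿ`).  Manin value `2(a[v/pⁿ]⁺ − (ℓ+1)[0]⁺) − 2a([v/pⁿ]⁺ − [0]⁺) = 2(a − ℓ − 1)[0]⁺` for an eigenform with `a_ℓ = a`.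
A SET; nothing asserted. [cite: MazurTateTeitelbaum1986Invent, §I.4 (4.2)] [cite: Manin1972, Prop. 1.4] -/
def heckeEigenLImages (N p ℓ : ℕ) (a : ℤ) : Set (Gamma0 N) :=
  {R | ∃ (n : ℕ) (b : ℤ) (g : Fin ℓ → Gamma0 N) (gℓ γ : Gamma0 N),
    (∀ j : Fin ℓ,
      (¬ ℓ ∣ (b : ZMod (p ^ n)).val + (j : ℕ) * p ^ n ∧ dEntry (g j) = (ℓ : ℤ) * (p : ℤ) ^ n ∧
          ((bEntry (g j) : ℤ) : ZMod (ℓ * p ^ n)) = (((b : ZMod (p ^ n)).val + (j : ℕ) * p ^ n : ℕ) : ZMod (ℓ * p ^ n))) ∨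
      (ℓ ∣ (b : ZMod (p ^ n)).val + (j : ℕ) * p ^ n ∧ dEntry (g j) = (p : ℤ) ^ n ∧
          (ℓ : ZMod (p ^ n)) * ((bEntry (g j) : ℤ) : ZMod (p ^ n)) = (b : ZMod (p ^ n)))) ∧
    dEntry gℓ = (p : ℤ) ^ n ∧ ((bEntry gℓ : ℤ) : ZMod (p ^ n)) = (ℓ : ZMod (p ^ n)) * (b : ZMod (p ^ n)) ∧
    dEntry γ = (p : ℤ) ^ n ∧ ((bEntry γ : ℤ) : ZMod (p ^ n)) = (b : ZMod (p ^ n)) ∧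
    R = (List.ofFn g).prod * gℓ * γ ^ (-a)}

/-- **The eigen-relators of a newform at `p`** — `heckeEigenRelators f p`: the Hecke relators of the second cut (`heckeRelators f p`:
`T_p`-images and the `T_ℓ`-images for `p ∣ a_ℓ(f)`) together with the eigen-corrected `T_ℓ`-image words `heckeEigenLImages N p ℓ a` for EVERY
prime `ℓ ≠ p`, `ℓ ∤ N` with integer eigenvalue `a_ℓ(f) = a`.  For a rational newform with `p ∣ a_p(f)` all of them are killed by Manin's
homomorphism of `f` once `[0]⁺_f ≡ 0` (`…TeichSpanHeckeEigen.isManinKilled_heckeEigenRelators`).  A SET; nothing asserted.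
[cite: MazurTateTeitelbaum1986Invent, §I.4 (4.2)] [cite: Manin1972, Prop. 1.4] -/
def heckeEigenRelators (f : CuspForm (Gamma0 N) 2) (p : ℕ) : Set (Gamma0 N) :=
  heckeRelators f p ∪ ⋃ x ∈ {x : ℕ × ℤ | x.1.Prime ∧ x.1 ≠ p ∧ ¬ x.1 ∣ N ∧ cuspCoeff f x.1 = (x.2 : ℂ)},
    heckeEigenLImages N p x.1 x.2

section EigenRelators

variable (f : CuspForm (Gamma0 N) 2) (p : ℕ)

/-- Constructor for `heckeEigenLImages`. [cite: MazurTateTeitelbaum1986Invent, §I.4 (4.2)] -/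
theorem prod_mul_mul_zpow_mem_heckeEigenLImages {p ℓ : ℕ} (a : ℤ) (n : ℕ) (b : ℤ) {g : Fin ℓ → Gamma0 N} {gℓ γ : Gamma0 N}
    (hg : ∀ j : Fin ℓ,
      (¬ ℓ ∣ (b : ZMod (p ^ n)).val + (j : ℕ) * p ^ n ∧ dEntry (g j) = (ℓ : ℤ) * (p : ℤ) ^ n ∧
          ((bEntry (g j) : ℤ) : ZMod (ℓ * p ^ n)) = (((b : ZMod (p ^ n)).val + (j : ℕ) * p ^ n : ℕ) : ZMod (ℓ * p ^ n))) ∨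
      (ℓ ∣ (b : ZMod (p ^ n)).val + (j : ℕ) * p ^ n ∧ dEntry (g j) = (p : ℤ) ^ n ∧
          (ℓ : ZMod (p ^ n)) * ((bEntry (g j) : ℤ) : ZMod (p ^ n)) = (b : ZMod (p ^ n))))
    (hd : dEntry gℓ = (p : ℤ) ^ n) (hb : ((bEntry gℓ : ℤ) : ZMod (p ^ n)) = (ℓ : ZMod (p ^ n)) * (b : ZMod (p ^ n)))
    (hdγ : dEntry γ = (p : ℤ) ^ n) (hbγ : ((bEntry γ : ℤ) : ZMod (p ^ n)) = (b : ZMod (p ^ n))) :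
    (List.ofFn g).prod * gℓ * γ ^ (-a) ∈ heckeEigenLImages N p ℓ a :=
  ⟨n, b, g, gℓ, γ, hg, hd, hb, hdγ, hbγ, rfl⟩

/-- The second cut's Hecke relators are eigen-relators. [cite: MazurTateTeitelbaum1986Invent, §I.4 (4.2)] -/
theorem heckeRelators_subset_heckeEigenRelators : heckeRelators f p ⊆ heckeEigenRelators f p :=
  Set.subset_union_left

variable {f p} in
/-- The eigen-corrected `T_ℓ`-image words of a prime `ℓ ≠ p`, `ℓ ∤ N` with `a_ℓ(f) = a ∈ ℤ` are eigen-relators.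
[cite: MazurTateTeitelbaum1986Invent, §I.4 (4.2)] -/
theorem heckeEigenLImages_subset_heckeEigenRelators {ℓ : ℕ} (hℓ : ℓ.Prime) (hℓp : ℓ ≠ p) (hℓN : ¬ ℓ ∣ N) {a : ℤ}
    (ha : cuspCoeff f ℓ = (a : ℂ)) : heckeEigenLImages N p ℓ a ⊆ heckeEigenRelators f p := by
  intro R hR
  refine Or.inr ?_
  simp only [Set.mem_iUnion, Set.mem_setOf_eq]
  exact ⟨(ℓ, a), ⟨hℓ, hℓp, hℓN, ha⟩, hR⟩

/-- Unfolding membership in `heckeEigenRelators`. [cite: MazurTateTeitelbaum1986Invent, §I.4 (4.2)] -/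
theorem mem_heckeEigenRelators_iff (R : Gamma0 N) :
    R ∈ heckeEigenRelators f p ↔ R ∈ heckeRelators f p ∨
      ∃ (ℓ : ℕ) (a : ℤ), (ℓ.Prime ∧ ℓ ≠ p ∧ ¬ ℓ ∣ N ∧ cuspCoeff f ℓ = (a : ℂ)) ∧ R ∈ heckeEigenLImages N p ℓ a := by
  simp only [heckeEigenRelators, Set.mem_union, Set.mem_iUnion, Set.mem_setOf_eq, exists_prop, Prod.exists]

/-- «B⁰ modulo the Hecke relators» (second cut) implies «B⁰ modulo the eigen-relators» (third cut): MORE relators, WEAKER hypothesis.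
[cite: Manin1972, Prop. 1.4] -/
theorem teichSpanGenMod_heckeEigenRelators_of_heckeRelators {p : ℕ} (h : TeichSpanGenMod N p (heckeRelators f p)) :
    TeichSpanGenMod N p (heckeEigenRelators f p) :=
  teichSpanGenMod_mono (heckeRelators_subset_heckeEigenRelators f p) h

end EigenRelators

end Summit.BirchSwinnertonDyer.BirchSwinnertonDyer.Theorems.SmallImageTeichSpanHecke

end
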